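import Summits.SmoothPoincare4.SmoothPoincare4.Theorems.ConvexBisectionAcyclicBisectionExistsPageTwistingTransverseLoop
import Summits.SmoothPoincare4.SmoothPoincare4.Theorems.ConvexBisectionAcyclicBisectionExistsPageTube
import Literature.Geometry.Symplectic.TwoHandleIsotopyHolds
import HarnessLib

/-!
# Gluing the boundary tube of a Lefschetz handle to a second tube, I: the first column of the fibre
# derivative read in `ℝ⁴`, and angles from winding numbers
(node T3c-1′ `node_belt_isotopic_pushoff` of the sub-goal T3 of stub `stub_steinRealisation` (NF6), line
`modp-braid-orbits`, crux `ConvexBisection.AcyclicBisectionExists`, item stmt-SmoothPoincare4-10508;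
wave 4, worker Y1, lead c5; brick (3c)-GLUE part 1, registered sub-goal `helper_belt_frameCol_ambient`)

Z5's tube comparison `helper_belt_slideToAnyTube` compares the boundary tube `Φ₁ = (h j).boundaryTube`
of the `j`-th handle of a Lefschetz link with a second tube `Φ₂` of `∂ Base g` around the attaching circle
`K`, under the hypotheses of `CircleTube.exists_diffeotopy_reflect`: same core, a sign `s` of the
orientation function, and a SMOOTH ANGLE `β` of the rotation field `u = A e₀ / ‖A e₀‖` of the transition
`Φ₂⁻¹ ∘ Φ₁` (`hang : frameVec Φ₁ Φ₂ x = R(β x) e₀`, i.e. `u` has degree `0`).  This file supplies these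
hypotheses for `Φ₂ := twistTube Φ σ` with `Φ` Z4's page-adapted tube (`helper_exists_pageTube`) and the
twist `σ = t_j` = the page twisting `∓1` of the handle (`IsLefschetzLink.twisting_eq`), in two files; here:

* §1 for two tubes with the same core, `wind (A e₀) = 0` gives a smooth angle (the second half of
  `exists_angle_of_framingHomotopic`, `TwoHandleIsotopyHolds.lean`, isolated);
* §2 **the first column `A(x) e₀` against an arbitrary second tube, read in `ℝ⁴`**: differentiating
  `Φ₂ ∘ τ = Φ₁` along the fibre direction `e₀` at the zero section,
  `ambient (handle framing) = c · K' + ∂_v (Φ₂ in ℝ⁴) (A e₀)` (`exists_ambient_attachingFraming_eq`);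
* §3 the twisted tube `twistTube Φ σ`: same core as `f♭`, fibre derivative `L ∘ fibreRot σ x` in `ℝ⁴`;
* §4 the registered helper `helper_belt_frameCol_ambient` (= §2).
The sequel `…BeltPageTubeGlue.lean` specialises §2 to the twisted page tube (`∂_v = [r iK' | κ rot] ∘ fibreRot σ x`,
so the twisting loop of the handle framing is an upper-triangular positive-diagonal image of
`fibreRot σ x (A e₀)` and `t_j = pageTwisting = σ + wind (A e₀)`), and delivers `helper_belt_pageTube_glue`.

Everything is proved; no named facts, no `sorry`.

## References
* A. A. Kosinski, *Differential Manifolds*, Academic Press (1993), III (3.1), (3.5). [Kosinski1993]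
* R. E. Gompf, A. I. Stipsicz, *4-Manifolds and Kirby Calculus* (1999), §4.5, §8.2. [GompfStipsicz1999]
-/

noncomputable section

-- the prescribed namespace `Summit.<P>.<Sub>.…` duplicates `SmoothPoincare4` (P = Sub)
set_option linter.dupNamespace false

open scoped Manifold ContDiff Topology
open Set Function Metric Filter Complex

namespace Summit.SmoothPoincare4.SmoothPoincare4.Theorems.AcyclicBisectionExists.ModpBraidOrbits

open Literature.Topology.FourManifolds Literature.Topology.FourManifolds.LefschetzBase
  Literature.Topology.FourManifolds.HandleAttachingMap Literature.Geometry.Symplectic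
  Literature.Topology.PlaneTopology

/-! ### §1 A rotation field of winding number zero has a smooth angle -/

section Angle

variable {Y : Type*} [TopologicalSpace Y] [ChartedSpace (EuclideanSpace ℝ (Fin 3)) Y]

/-- **Winding number zero gives a smooth angle.**  For two tubes `Φ₁`, `Φ₂` around the same circle, if
the loop `t ↦ A(e^{2πit}) e₀` of first columns of the fibre derivative has winding number `0` about the
origin, then the rotation field `u = A e₀/‖A e₀‖` has a smooth angle: `u(x) = R(β x) e₀`.  (The degree `d`
of `u` from `exists_int_angle_of_rotationField` is this winding number.) [cite: GompfStipsicz1999, §4.5] -/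
theorem exists_angle_of_wind_frameCol_eq_zero {Φ₁ Φ₂ : CircleTube Y} (hcore : ∀ θ, Φ₁.core θ = Φ₂.core θ)
    (hw : wind (fun t => toC (CircleTube.frameCol Φ₁ Φ₂ (circlePt t))) = 0) :
    ∃ β : sphere (0 : EuclideanSpace ℝ (Fin 2)) 1 → ℝ, ContMDiff (𝓡 1) 𝓘(ℝ, ℝ) ∞ β ∧
      ∀ x, CircleTube.frameVec Φ₁ Φ₂ x = rotPlane (β x) planeE0 := by
  obtain ⟨d, β, hβ, hrot⟩ := exists_int_angle_of_rotationField (CircleTube.contMDiff_frameUnit hcore)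
  have hvec : ∀ φ : ℝ, CircleTube.frameVec Φ₁ Φ₂ (circlePoint φ) = rotPlane (β (circlePoint φ) + d * φ) planeE0 := by
    intro φ
    have h1 := hrot φ planeE0
    simp only [planeE0_apply_zero, planeE0_apply_one, one_smul, zero_smul, add_zero] at h1
    calc CircleTube.frameVec Φ₁ Φ₂ (circlePoint φ)
        = rotPlane (β (circlePoint φ)) (rotPlane (-β (circlePoint φ)) (CircleTube.frameVec Φ₁ Φ₂ (circlePoint φ))) :=
          (rotPlane_rotPlane_neg _ _).symm
      _ = rotPlane (β (circlePoint φ)) (rotPlane (d * φ) planeE0) := by rw [h1]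
      _ = rotPlane (β (circlePoint φ) + d * φ) planeE0 := (rotPlane_add _ _ _).symm
  set F : sphere (0 : EuclideanSpace ℝ (Fin 2)) 1 → EuclideanSpace ℝ (Fin 2) := CircleTube.frameCol Φ₁ Φ₂ with hF_def
  have hFne : ∀ x, F x ≠ 0 := fun x => CircleTube.frameCol_ne_zero hcore x
  have hFc : Continuous F := (CircleTube.contMDiff_frameCol hcore).continuous
  set ψ : ℝ → ℝ := fun t => β (circlePt t) + d * (2 * Real.pi * t) with hψ_def
  set l : ℝ → ℂ := fun t => (Real.log ‖F (circlePt t)‖ : ℂ) + (ψ t : ℂ) * Complex.I with hl_def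
  have hl : ContinuousOn l (Icc 0 1) := by
    have h1 : Continuous fun t : ℝ => Real.log ‖F (circlePt t)‖ :=
      (continuous_norm.comp (hFc.comp continuous_circlePt)).log fun t => (norm_pos_iff.2 (hFne _)).ne'
    have h2 : Continuous ψ :=
      (hβ.continuous.comp continuous_circlePt).add (continuous_const.mul (continuous_const.mul continuous_id))
    exact ((Complex.continuous_ofReal.comp h1).add
      ((Complex.continuous_ofReal.comp h2).mul continuous_const)).continuousOn
  have hexp : ∀ t ∈ Icc (0 : ℝ) 1, Complex.exp (l t) = toC (CircleTube.frameCol Φ₁ Φ₂ (circlePt t)) := by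
    intro t _
    have hpos : 0 < ‖F (circlePt t)‖ := norm_pos_iff.2 (hFne _)
    have hFt : F (circlePt t) = ‖F (circlePt t)‖ • rotPlane (ψ t) planeE0 := by
      have h1 : ‖F (circlePt t)‖ • CircleTube.frameVec Φ₁ Φ₂ (circlePt t) = F (circlePt t) :=
        NormedSpace.norm_smul_normalize _
      have h2 : CircleTube.frameVec Φ₁ Φ₂ (circlePt t) = rotPlane (ψ t) planeE0 := by
        rw [circlePt_eq_circlePoint, hvec]
        rfl
      rw [h2] at h1
      exact h1.symm
    show Complex.exp (l t) = toC (F (circlePt t))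
    rw [hFt, toC_smul_rotPlane_planeE0 hpos]
  have h01 : toC (CircleTube.frameCol Φ₁ Φ₂ (circlePt 0)) = toC (CircleTube.frameCol Φ₁ Φ₂ (circlePt 1)) := by
    rw [circlePt_one_eq_zero]
  have hspec := wind_spec hl hexp h01
  rw [hw, Int.cast_zero, zero_mul] at hspec
  have hdiff : l 1 - l 0 = (d : ℂ) * (2 * Real.pi * Complex.I) := by
    simp only [hl_def, hψ_def, circlePt_one_eq_zero]
    push_cast
    ring
  rw [hdiff] at hspec
  have hd : d = 0 := by
    apply int_eq_of_mul_two_pi_I_eq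
    rw [hspec, Int.cast_zero, zero_mul]
  refine ⟨β, hβ, fun x => ?_⟩
  obtain ⟨φ, rfl⟩ := circlePoint_surjective x
  rw [hvec φ, hd, Int.cast_zero, zero_mul, add_zero]

end Angle

/-! ### §2 The first column of the fibre derivative against an arbitrary second tube, read in `ℝ⁴` -/

section Column

variable {g : ℕ}

/-- The tube point `Φ₂ (q)` of a tube of `∂ Base g`, read in `ℝ⁴`. [folklore] -/
theorem contMDiffAt_coe_tube (Φ₂ : CircleTube (bBase g).carrier)
    {q : (sphere (0 : EuclideanSpace ℝ (Fin 2)) 1) × EuclideanSpace ℝ (Fin 2)} (hq : q ∈ Φ₂.toHomeo.source) :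
    ContMDiffAt ((𝓡 1).prod 𝓘(ℝ, EuclideanSpace ℝ (Fin 2))) 𝓘(ℝ, EuclideanSpace ℝ (Fin 4)) ∞
      (fun q => RegularSublevel.incl (isRegularLevel_rho g) ((bBase g).incl (Φ₂.toHomeo q))) q :=
  ((RegularSublevel.contMDiff_incl (isRegularLevel_rho g)).comp
    (bBase g).isSmoothEmbedding.contMDiff).contMDiffAt.comp q (Φ₂.contMDiffAt_toHomeo hq)

/-- **The handle framing against a second tube, in `ℝ⁴`.**  Let `f` be an attaching map of a 2-handle on
`Base g` with attaching circle `K`, `Φ₂` a tube of `∂ Base g` with the same core as the boundary tube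
`Φ₁ = f♭`, and `L = ∂_v|₀ (Φ₂ (e^{2πit}, v))` the fibre derivative of `Φ₂` read in `ℝ⁴`.  Then the handle
framing read in `ℝ⁴` is `L (A e₀)` up to a multiple of the velocity `K'(t)`:
`ambient (ν_f) = c · K' + L (A(e^{2πit}) e₀)`, `A` the fibre derivative of the transition `Φ₂⁻¹ ∘ Φ₁`
(differentiate `Φ₂ ∘ τ = Φ₁` along `v ↦ (x, v)` at `v = 0`: the handle framing is the velocity of `f`
along the arc `s ↦ (cos s θ, sin s, 0)`, the sphere point of fibre `sin s e₀`; the block structure of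
`dτ` puts `A e₀` in the fibre slot, and the circle slot only contributes multiples of `K'`).
[cite: Kosinski1993, III (3.1)] -/
theorem exists_ambient_attachingFraming_eq (f : HandleAttachingMap 3 2 (Base g)) {Φ₂ : CircleTube (bBase g).carrier}
    (hcore : ∀ θ, f.boundaryTube.core θ = Φ₂.core θ) (t : ℝ)
    {L : EuclideanSpace ℝ (Fin 2) →L[ℝ] EuclideanSpace ℝ (Fin 4)}
    (hL : HasFDerivAt (fun v : EuclideanSpace ℝ (Fin 2) => (((bBase g).incl (Φ₂.toHomeo (circlePt t, v)) : Base g)).1) L 0) :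
    ∃ c : ℝ, ambient g (f.attachingCircle (circlePt t)) (f.attachingFraming (circlePt t)) =
      c • deriv (ambCurve g f.attachingCircle) t + L (CircleTube.frameCol f.boundaryTube Φ₂ (circlePt t)) := by
  -- the tube `Φ₂` read in `ℝ⁴` and its differential `D` at `(x, 0)`, `x = e^{2πit}`
  set P : (sphere (0 : EuclideanSpace ℝ (Fin 2)) 1) × EuclideanSpace ℝ (Fin 2) → EuclideanSpace ℝ (Fin 4) :=
    fun q => RegularSublevel.incl (isRegularLevel_rho g) ((bBase g).incl (Φ₂.toHomeo q)) with hP_def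
  have hP : ContMDiffAt ((𝓡 1).prod 𝓘(ℝ, EuclideanSpace ℝ (Fin 2))) 𝓘(ℝ, EuclideanSpace ℝ (Fin 4)) ∞ P (circlePt t, 0) :=
    contMDiffAt_coe_tube Φ₂ (Φ₂.mem_source_zero (circlePt t))
  have hPd : MDifferentiableAt ((𝓡 1).prod 𝓘(ℝ, EuclideanSpace ℝ (Fin 2))) 𝓘(ℝ, EuclideanSpace ℝ (Fin 4)) P (circlePt t, 0) :=
    hP.mdifferentiableAt (by simp)
  set D := mfderiv ((𝓡 1).prod 𝓘(ℝ, EuclideanSpace ℝ (Fin 2))) 𝓘(ℝ, EuclideanSpace ℝ (Fin 4)) P (circlePt t, 0) with hD_def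
  -- (i) the fibre slot: `D (0, a) = L a`
  have hfib : ∀ a : EuclideanSpace ℝ (Fin 2),
      D ((0, a) : TangentSpace ((𝓡 1).prod 𝓘(ℝ, EuclideanSpace ℝ (Fin 2))) ((circlePt t, (0 : EuclideanSpace ℝ (Fin 2))) :
        (sphere (0 : EuclideanSpace ℝ (Fin 2)) 1) × EuclideanSpace ℝ (Fin 2))) = L a := by
    intro a
    have hι : HasMFDerivAt 𝓘(ℝ, EuclideanSpace ℝ (Fin 2)) ((𝓡 1).prod 𝓘(ℝ, EuclideanSpace ℝ (Fin 2)))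
        (fun v : EuclideanSpace ℝ (Fin 2) => ((circlePt t, v) : (sphere (0 : EuclideanSpace ℝ (Fin 2)) 1) × EuclideanSpace ℝ (Fin 2))) 0
        ((0 : EuclideanSpace ℝ (Fin 2) →L[ℝ] TangentSpace (𝓡 1) (circlePt t)).prod (ContinuousLinearMap.id ℝ (EuclideanSpace ℝ (Fin 2)))) :=
      (hasMFDerivAt_const (I := 𝓘(ℝ, EuclideanSpace ℝ (Fin 2))) (I' := 𝓡 1) (circlePt t) 0).prodMk (hasMFDerivAt_id (I := 𝓘(ℝ, EuclideanSpace ℝ (Fin 2))) 0)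
    have hc := hPd.hasMFDerivAt.comp 0 hι
    have hc' : HasFDerivAt (fun v : EuclideanSpace ℝ (Fin 2) => P (circlePt t, v))
        (D.comp (((0 : EuclideanSpace ℝ (Fin 2) →L[ℝ] TangentSpace (𝓡 1) (circlePt t)).prod (ContinuousLinearMap.id ℝ (EuclideanSpace ℝ (Fin 2)))))) 0 :=
      hasMFDerivAt_iff_hasFDerivAt.1 hc
    have hLe := hL.unique hc'
    rw [hLe]
    rfl
  -- (ii) the circle slot: `D (ξ, 0) ∈ ℝ · K'(t)`
  have hcirc : ∀ ξ : TangentSpace (𝓡 1) (circlePt t), ∃ c : ℝ,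
      D ((ξ, 0) : TangentSpace ((𝓡 1).prod 𝓘(ℝ, EuclideanSpace ℝ (Fin 2))) ((circlePt t, (0 : EuclideanSpace ℝ (Fin 2))) :
        (sphere (0 : EuclideanSpace ℝ (Fin 2)) 1) × EuclideanSpace ℝ (Fin 2))) = c • deriv (ambCurve g f.attachingCircle) t := by
    intro ξ
    have hι : HasMFDerivAt (𝓡 1) ((𝓡 1).prod 𝓘(ℝ, EuclideanSpace ℝ (Fin 2)))
        (fun y : sphere (0 : EuclideanSpace ℝ (Fin 2)) 1 => ((y, (0 : EuclideanSpace ℝ (Fin 2))) :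
          (sphere (0 : EuclideanSpace ℝ (Fin 2)) 1) × EuclideanSpace ℝ (Fin 2))) (circlePt t)
        ((ContinuousLinearMap.id ℝ (TangentSpace (𝓡 1) (circlePt t))).prod (0 : TangentSpace (𝓡 1) (circlePt t) →L[ℝ] EuclideanSpace ℝ (Fin 2))) :=
      (hasMFDerivAt_id (I := 𝓡 1) (circlePt t)).prodMk (hasMFDerivAt_const (I := 𝓡 1) (I' := 𝓘(ℝ, EuclideanSpace ℝ (Fin 2))) (0 : EuclideanSpace ℝ (Fin 2)) (circlePt t))
    have hc := hPd.hasMFDerivAt.comp (circlePt t) hι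
    have hfun : (P ∘ fun y : sphere (0 : EuclideanSpace ℝ (Fin 2)) 1 => ((y, (0 : EuclideanSpace ℝ (Fin 2))) :
        (sphere (0 : EuclideanSpace ℝ (Fin 2)) 1) × EuclideanSpace ℝ (Fin 2))) =
        fun y => RegularSublevel.incl (isRegularLevel_rho g) (f.attachingCircle y) := by
      funext y
      show RegularSublevel.incl (isRegularLevel_rho g) ((bBase g).incl (Φ₂.toHomeo (y, 0))) =
        RegularSublevel.incl (isRegularLevel_rho g) (f.attachingCircle y)
      rw [← CircleTube.core_apply, ← hcore y, ← HandleAttachingMap.coe_boundaryTube_core]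
      rfl
    rw [hfun] at hc
    -- `ξ` is a multiple of `d(circlePt)/dt`
    set D1 : EuclideanSpace ℝ (Fin 1) := mfderiv 𝓘(ℝ, ℝ) (𝓡 1) circlePt t 1 with hD1_def
    obtain ⟨c, hcξ⟩ := exists_smul_eq_of_ne_zero_fin_one (mfderiv_circlePt_one_ne_zero t) ξ
    refine ⟨c, ?_⟩
    have hK₄ : ContMDiff (𝓡 1) 𝓘(ℝ, EuclideanSpace ℝ (Fin 4)) ∞ fun y => RegularSublevel.incl (isRegularLevel_rho g) (f.attachingCircle y) :=
      (RegularSublevel.contMDiff_incl (isRegularLevel_rho g)).comp (isSmoothEmbedding_attachingCircle f).contMDiff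
    have hDT : mfderiv (𝓡 1) 𝓘(ℝ, EuclideanSpace ℝ (Fin 4)) (fun y => RegularSublevel.incl (isRegularLevel_rho g) (f.attachingCircle y)) (circlePt t) D1 =
        deriv (ambCurve g f.attachingCircle) t := by
      have hcomp := mfderiv_comp t (hK₄.mdifferentiableAt (x := circlePt t) (by simp))
        (contMDiff_circlePt.mdifferentiableAt (by simp))
      have key := (DFunLike.congr_fun hcomp (1 : ℝ)).symm
      rw [mfderiv_eq_fderiv] at key
      exact key
    have e1 : D ((ξ, 0) : TangentSpace ((𝓡 1).prod 𝓘(ℝ, EuclideanSpace ℝ (Fin 2))) ((circlePt t, (0 : EuclideanSpace ℝ (Fin 2))) :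
        (sphere (0 : EuclideanSpace ℝ (Fin 2)) 1) × EuclideanSpace ℝ (Fin 2))) =
        mfderiv (𝓡 1) 𝓘(ℝ, EuclideanSpace ℝ (Fin 4)) (fun y => RegularSublevel.incl (isRegularLevel_rho g) (f.attachingCircle y)) (circlePt t) ξ := by
      rw [hc.mfderiv]
      rfl
    rw [e1, hcξ]
    have e2 := (mfderiv (𝓡 1) 𝓘(ℝ, EuclideanSpace ℝ (Fin 4)) (fun y => RegularSublevel.incl (isRegularLevel_rho g) (f.attachingCircle y)) (circlePt t)).map_smul c D1
    exact e2.trans (congrArg (fun v : EuclideanSpace ℝ (Fin 4) => c • v) hDT)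
  -- (iii) the transition along the fibre: `v ↦ τ (x, v)`, its differential `T`, `(T e₀).2 = A e₀`
  set τ := CircleTube.transition f.boundaryTube Φ₂ with hτ_def
  have hτ : ContMDiffAt ((𝓡 1).prod 𝓘(ℝ, EuclideanSpace ℝ (Fin 2))) ((𝓡 1).prod 𝓘(ℝ, EuclideanSpace ℝ (Fin 2))) ∞ τ (circlePt t, 0) :=
    CircleTube.contMDiffAt_transition (CircleTube.mem_transitionDom_zero hcore (circlePt t))
  have hτv : MDifferentiableAt 𝓘(ℝ, EuclideanSpace ℝ (Fin 2)) ((𝓡 1).prod 𝓘(ℝ, EuclideanSpace ℝ (Fin 2)))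
      (fun v : EuclideanSpace ℝ (Fin 2) => τ (circlePt t, v)) 0 :=
    CircleTube.mdifferentiableAt_transition_fibre hcore (circlePt t)
  set T := mfderiv 𝓘(ℝ, EuclideanSpace ℝ (Fin 2)) ((𝓡 1).prod 𝓘(ℝ, EuclideanSpace ℝ (Fin 2)))
      (fun v : EuclideanSpace ℝ (Fin 2) => τ (circlePt t, v)) 0 with hT_def
  have hT2 : (T planeE0).2 = CircleTube.frameCol f.boundaryTube Φ₂ (circlePt t) := by
    have hs := hasMFDerivAt_snd (I := 𝓡 1) (I' := 𝓘(ℝ, EuclideanSpace ℝ (Fin 2))) (τ (circlePt t, 0))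
    have hc := hs.comp 0 hτv.hasMFDerivAt
    have e : (T planeE0).2 = mfderiv 𝓘(ℝ, EuclideanSpace ℝ (Fin 2)) 𝓘(ℝ, EuclideanSpace ℝ (Fin 2))
        (Prod.snd ∘ fun v : EuclideanSpace ℝ (Fin 2) => τ (circlePt t, v)) 0 planeE0 := by
      rw [hc.mfderiv]; rfl
    rw [e, mfderiv_eq_fderiv]
    rfl
  -- (iv) the fibre map `G v = P (τ (x, v))` agrees near `0` with `v ↦ f (depthLine x v 0)` read in `ℝ⁴`
  set G : EuclideanSpace ℝ (Fin 2) → EuclideanSpace ℝ (Fin 4) := fun v => P (τ (circlePt t, v)) with hG_def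
  have hτ0 : τ (circlePt t, 0) = (circlePt t, 0) := CircleTube.transition_zero hcore (circlePt t)
  have hPd' : MDifferentiableAt ((𝓡 1).prod 𝓘(ℝ, EuclideanSpace ℝ (Fin 2))) 𝓘(ℝ, EuclideanSpace ℝ (Fin 4)) P (τ (circlePt t, 0)) := by
    rw [hτ0]; exact hPd
  have hGm := hPd'.hasMFDerivAt.comp 0 hτv.hasMFDerivAt
  have hG : HasFDerivAt G ((mfderiv ((𝓡 1).prod 𝓘(ℝ, EuclideanSpace ℝ (Fin 2))) 𝓘(ℝ, EuclideanSpace ℝ (Fin 4)) P (τ (circlePt t, 0))).comp T) 0 :=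
    hasMFDerivAt_iff_hasFDerivAt.1 hGm
  have hGD : HasFDerivAt G (D.comp T) 0 := by
    have key : ∀ (q : (sphere (0 : EuclideanSpace ℝ (Fin 2)) 1) × EuclideanSpace ℝ (Fin 2))
        (_ : q = ((circlePt t, (0 : EuclideanSpace ℝ (Fin 2))) : (sphere (0 : EuclideanSpace ℝ (Fin 2)) 1) × EuclideanSpace ℝ (Fin 2))),
        HasFDerivAt G ((mfderiv ((𝓡 1).prod 𝓘(ℝ, EuclideanSpace ℝ (Fin 2))) 𝓘(ℝ, EuclideanSpace ℝ (Fin 4)) P q).comp T) 0 →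
        HasFDerivAt G (D.comp T) 0 := by
      intro q e h; subst e; exact h
    exact key _ hτ0 hG
  -- (v) the handle framing in `ℝ⁴` is the velocity of `s ↦ G (sin s • e₀)`
  have hdom : ∀ᶠ s in 𝓝 (0 : ℝ), ((circlePt t, Real.sin s • planeE0) : (sphere (0 : EuclideanSpace ℝ (Fin 2)) 1) × EuclideanSpace ℝ (Fin 2)) ∈
      CircleTube.transitionDom f.boundaryTube Φ₂ := by
    have hcont : Continuous fun s : ℝ => ((circlePt t, Real.sin s • planeE0) : (sphere (0 : EuclideanSpace ℝ (Fin 2)) 1) × EuclideanSpace ℝ (Fin 2)) :=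
      continuous_const.prodMk (Real.continuous_sin.smul continuous_const)
    have h0 : ((circlePt t, Real.sin (0 : ℝ) • planeE0) : (sphere (0 : EuclideanSpace ℝ (Fin 2)) 1) × EuclideanSpace ℝ (Fin 2)) = (circlePt t, 0) := by
      simp
    have := hcont.continuousAt (x := 0)
    rw [ContinuousAt, h0] at this
    exact this (CircleTube.transitionDom_mem_nhds_zero hcore (circlePt t))
  have hev : (RegularSublevel.incl (isRegularLevel_rho g) ∘ (f.toFun ∘ tubeArcPt (circlePt t))) =ᶠ[𝓝 0]
      fun s : ℝ => G (Real.sin s • planeE0) := by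
    filter_upwards [eventually_cos_pos, hdom] with s hs hsd
    have e1 := CircleTube.apply_transition hsd
    show RegularSublevel.incl (isRegularLevel_rho g) (f.toFun (tubeArcPt (circlePt t) s)) =
      RegularSublevel.incl (isRegularLevel_rho g) ((bBase g).incl (Φ₂.toHomeo (τ (circlePt t, Real.sin s • planeE0))))
    rw [tubeArcPt_eq_depthLine hs]
    exact (congrArg (fun p : (bBase g).carrier => RegularSublevel.incl (isRegularLevel_rho g) ((bBase g).incl p)) e1).symm
  have hsin : HasDerivAt (fun s : ℝ => Real.sin s • planeE0) planeE0 0 := by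
    have h := (Real.hasDerivAt_sin 0).smul_const planeE0
    rwa [Real.cos_zero, one_smul] at h
  have hcurve : HasDerivAt (fun s : ℝ => G (Real.sin s • planeE0)) ((D.comp T) planeE0) 0 := by
    have hG0 : HasFDerivAt G (D.comp T) (Real.sin (0 : ℝ) • planeE0) := by
      rw [Real.sin_zero, zero_smul]; exact hGD
    exact HasFDerivAt.comp_hasDerivAt (x := (0 : ℝ)) (f := fun s : ℝ => Real.sin s • planeE0) hG0 hsin
  have hγc : ContMDiffAt 𝓘(ℝ, ℝ) (𝓡∂ 4) ∞ (tubeArcPt (circlePt t)) 0 :=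
    contMDiffAt_tubeArcPt (by rw [Real.cos_zero]; exact one_pos)
  have hγ : MDifferentiableAt 𝓘(ℝ, ℝ) (𝓡∂ 4) (f.toFun ∘ tubeArcPt (circlePt t)) 0 :=
    (mdifferentiableAt_handleAttachingMap f _).comp 0 (hγc.mdifferentiableAt (by simp))
  have h0 : (f.toFun ∘ tubeArcPt (circlePt t)) 0 = f.attachingCircle (circlePt t) := by
    rw [comp_apply, tubeArcPt_zero]; rfl
  have hι : MDifferentiableAt (𝓡∂ 4) (𝓡 4) (RegularSublevel.incl (isRegularLevel_rho g)) ((f.toFun ∘ tubeArcPt (circlePt t)) 0) :=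
    (RegularSublevel.contMDiff_incl _).mdifferentiableAt (by simp)
  have hchain := mfderiv_comp 0 hι hγ
  have hamb : ambient g (f.attachingCircle (circlePt t)) (f.attachingFraming (circlePt t)) =
      mfderiv 𝓘(ℝ, ℝ) (𝓡 4) (RegularSublevel.incl (isRegularLevel_rho g) ∘ (f.toFun ∘ tubeArcPt (circlePt t))) 0 (1 : ℝ) := by
    rw [attachingFraming_eq_mfderiv_comp_tubeArcPt, hchain]
    exact congrArg (fun z : Base g => mfderiv (𝓡∂ 4) (𝓡 4) (RegularSublevel.incl (isRegularLevel_rho g)) z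
      (mfderiv 𝓘(ℝ, ℝ) (𝓡∂ 4) (f.toFun ∘ tubeArcPt (circlePt t)) 0 (1 : ℝ))) h0.symm
  have hmf : HasMFDerivAt 𝓘(ℝ, ℝ) (𝓡 4) (RegularSublevel.incl (isRegularLevel_rho g) ∘ (f.toFun ∘ tubeArcPt (circlePt t))) 0
      (ContinuousLinearMap.smulRight (1 : ℝ →L[ℝ] ℝ) ((D.comp T) planeE0)) :=
    hasMFDerivAt_iff_hasFDerivAt.2 (hcurve.congr_of_eventuallyEq hev).hasFDerivAt
  have hval : ambient g (f.attachingCircle (circlePt t)) (f.attachingFraming (circlePt t)) = D (T planeE0) := by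
    rw [hamb, hmf.mfderiv]
    show (1 : ℝ) • (D.comp T) planeE0 = D (T planeE0)
    rw [one_smul]; rfl
  -- (vi) split `T e₀ = ((T e₀).1, 0) + (0, A e₀)`
  obtain ⟨c, hc⟩ := hcirc (T planeE0).1
  refine ⟨c, ?_⟩
  have hTab : (T planeE0 : TangentSpace ((𝓡 1).prod 𝓘(ℝ, EuclideanSpace ℝ (Fin 2))) ((circlePt t, (0 : EuclideanSpace ℝ (Fin 2))) :
        (sphere (0 : EuclideanSpace ℝ (Fin 2)) 1) × EuclideanSpace ℝ (Fin 2))) =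
      (((T planeE0).1, 0) : TangentSpace ((𝓡 1).prod 𝓘(ℝ, EuclideanSpace ℝ (Fin 2))) ((circlePt t, (0 : EuclideanSpace ℝ (Fin 2))) :
        (sphere (0 : EuclideanSpace ℝ (Fin 2)) 1) × EuclideanSpace ℝ (Fin 2))) +
      (((0, (T planeE0).2)) : TangentSpace ((𝓡 1).prod 𝓘(ℝ, EuclideanSpace ℝ (Fin 2))) ((circlePt t, (0 : EuclideanSpace ℝ (Fin 2))) :
        (sphere (0 : EuclideanSpace ℝ (Fin 2)) 1) × EuclideanSpace ℝ (Fin 2))) :=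
    Prod.ext (by simp) (by simp)
  have hsum : D (T planeE0) =
      @id (EuclideanSpace ℝ (Fin 4)) (D ((((T planeE0).1, 0)) : TangentSpace ((𝓡 1).prod 𝓘(ℝ, EuclideanSpace ℝ (Fin 2)))
        ((circlePt t, (0 : EuclideanSpace ℝ (Fin 2))) : (sphere (0 : EuclideanSpace ℝ (Fin 2)) 1) × EuclideanSpace ℝ (Fin 2)))) +
      @id (EuclideanSpace ℝ (Fin 4)) (D (((0, (T planeE0).2)) : TangentSpace ((𝓡 1).prod 𝓘(ℝ, EuclideanSpace ℝ (Fin 2)))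
        ((circlePt t, (0 : EuclideanSpace ℝ (Fin 2))) : (sphere (0 : EuclideanSpace ℝ (Fin 2)) 1) × EuclideanSpace ℝ (Fin 2)))) := by
    rw [show D (T planeE0) = D ((((T planeE0).1, 0) : TangentSpace ((𝓡 1).prod 𝓘(ℝ, EuclideanSpace ℝ (Fin 2)))
        ((circlePt t, (0 : EuclideanSpace ℝ (Fin 2))) : (sphere (0 : EuclideanSpace ℝ (Fin 2)) 1) × EuclideanSpace ℝ (Fin 2))) +
      (((0, (T planeE0).2)) : TangentSpace ((𝓡 1).prod 𝓘(ℝ, EuclideanSpace ℝ (Fin 2)))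
        ((circlePt t, (0 : EuclideanSpace ℝ (Fin 2))) : (sphere (0 : EuclideanSpace ℝ (Fin 2)) 1) × EuclideanSpace ℝ (Fin 2))))
      from congrArg D hTab]
    exact D.map_add _ _
  rw [hval, hsum, hc, hfib, hT2]
  rfl

end Column

/-! ### §3 The twisted page tube: same core, fibre derivative `L ∘ fibreRot σ x` -/

section TwistedPage

variable {g : ℕ}

/-- The boundary tube of an attaching map and the twisted page tube around its attaching circle have the
same core. [folklore] -/
theorem boundaryTube_core_eq_twistTube (f : HandleAttachingMap 3 2 (Base g)) (Φ : CircleTube (bBase g).carrier)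
    (hΦcore : ∀ ψ, (bBase g).incl (Φ.core ψ) = f.attachingCircle ψ) (σ : ℝ) (hσ : σ ^ 2 = 1)
    (θ : sphere (0 : EuclideanSpace ℝ (Fin 2)) 1) : f.boundaryTube.core θ = (twistTube Φ σ hσ).core θ := by
  apply Subtype.ext
  rw [HandleAttachingMap.coe_boundaryTube_core, twistTube_core, ← hΦcore θ]
  rfl

/-- `toC` of a twisted fibre vector: complex multiplication by `u₀ + i σ u₁`. [folklore] -/
theorem toC_fibreRot (σ : ℝ) (u w : EuclideanSpace ℝ (Fin 2)) :
    toC (fibreRot σ u w) = (⟨u 0, σ * u 1⟩ : ℂ) * toC w := by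
  apply Complex.ext
  · simp [fibreRot_apply_zero, Complex.mul_re]
  · simp [fibreRot_apply_one, Complex.mul_im]; ring

/-- **The fibre derivative of the twisted tube in `ℝ⁴` is `L ∘ fibreRot σ x`** (`L` that of `Φ`). [folklore] -/
theorem hasFDerivAt_twistTube_fibre (Φ : CircleTube (bBase g).carrier) (σ : ℝ) (hσ : σ ^ 2 = 1) (t : ℝ)
    {L : EuclideanSpace ℝ (Fin 2) →L[ℝ] EuclideanSpace ℝ (Fin 4)}
    (hL : HasFDerivAt (fun v : EuclideanSpace ℝ (Fin 2) => ((bBase g).incl (Φ.toHomeo (circlePt t, v))).1) L 0) :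
    ∃ L₂ : EuclideanSpace ℝ (Fin 2) →L[ℝ] EuclideanSpace ℝ (Fin 4),
      (∀ w, L₂ w = L (fibreRot σ (circlePt t : EuclideanSpace ℝ (Fin 2)) w)) ∧
      HasFDerivAt (fun v : EuclideanSpace ℝ (Fin 2) =>
        ((bBase g).incl ((twistTube Φ σ hσ).toHomeo (circlePt t, v))).1) L₂ 0 := by
  set Rl : EuclideanSpace ℝ (Fin 2) →L[ℝ] EuclideanSpace ℝ (Fin 2) := LinearMap.toContinuousLinearMap
    { toFun := fibreRot σ (circlePt t : EuclideanSpace ℝ (Fin 2))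
      map_add' := fibreRot_add σ _
      map_smul' := fun c w => fibreRot_smul σ _ c w } with hRl
  have hRl' : ∀ w, Rl w = fibreRot σ (circlePt t : EuclideanSpace ℝ (Fin 2)) w := fun _ => rfl
  refine ⟨L.comp Rl, fun w => rfl, ?_⟩
  have h0 : Rl 0 = 0 := map_zero Rl
  have hL' : HasFDerivAt (fun v : EuclideanSpace ℝ (Fin 2) => ((bBase g).incl (Φ.toHomeo (circlePt t, v))).1) L (Rl 0) := by
    rw [h0]; exact hL
  exact hL'.comp 0 Rl.hasFDerivAt

end TwistedPage


/-! ### §4 Registered helper -/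

/-- **Registered helper `helper_belt_frameCol_ambient` (node T3c-1′ of NF6 `stub_steinRealisation`, brick
(3c)-GLUE part 1, wave 4, lead c5): the handle framing against a second tube, read in `ℝ⁴`.**  For an
attaching map `f` of a 2-handle on `Base g` and a tube `Φ₂` of `∂ Base g` with the same core as `f♭`, with
fibre derivative `L = ∂_v|₀ Φ₂(e^{2πit}, v)` in `ℝ⁴`: `ambient (ν_f) = c · K' + L (A(e^{2πit}) e₀)` for some
real `c`, `A` the fibre derivative of the transition `Φ₂⁻¹ ∘ f♭`. [cite: Kosinski1993, III (3.1)] -/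
theorem helper_belt_frameCol_ambient : ∀ (g : ℕ) (f : Literature.Topology.FourManifolds.HandleAttachingMap 3 2 (Literature.Topology.FourManifolds.LefschetzBase.Base g)) (Φ₂ : Literature.Topology.FourManifolds.CircleTube (Literature.Topology.FourManifolds.LefschetzBase.bBase g).carrier), (∀ θ, f.boundaryTube.core θ = Φ₂.core θ) → ∀ (t : ℝ) (L : EuclideanSpace ℝ (Fin 2) →L[ℝ] EuclideanSpace ℝ (Fin 4)), HasFDerivAt (fun v : EuclideanSpace ℝ (Fin 2) => ((Literature.Topology.FourManifolds.LefschetzBase.bBase g).incl (Φ₂.toHomeo (Literature.Topology.FourManifolds.circlePt t, v))).1) L 0 → ∃ c : ℝ, Literature.Topology.FourManifolds.LefschetzBase.ambient g (f.attachingCircle (Literature.Topology.FourManifolds.circlePt t)) (f.attachingFraming (Literature.Topology.FourManifolds.circlePt t)) = c • deriv (Literature.Topology.FourManifolds.LefschetzBase.ambCurve g f.attachingCircle) t + L (Literature.Topology.FourManifolds.CircleTube.frameCol f.boundaryTube Φ₂ (Literature.Topology.FourManifolds.circlePt t)) := by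
  intro g f Φ₂ hcore t L hL
  exact exists_ambient_attachingFraming_eq f hcore t hL

end Summit.SmoothPoincare4.SmoothPoincare4.Theorems.AcyclicBisectionExists.ModpBraidOrbits

end
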